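import Summits.Ventures.LatticeQCDFlow.Exactness.HeatBathSweepErgodic
import HarnessLib

/-!
# Doeblin chains decorrelate every pair of events geometrically; so does the heat-bath sweep

HONEST FRAMING: exact (Metropolis-corrected) sampling algorithms for lattice gauge theory;
figures of merit are autocorrelation/cost numbers at stated couplings and volumes; no
continuum-physics claim.

Venture `LatticeQCDFlow` (cell pub-lqcd), topic `Exactness`, FANOUT row 9 (eng-latcore, the
engine `latflow.core`).  NEW WORK of the cell over Mathlib kernels (`Measure.compProd`, the tree's
`nHit` iterates of `Exactness/InvariantComposition.lean`) and the tree's formalisation of Doeblin's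
theorem (`Literature.Probability.MarkovChains.Doeblin.doeblin_iterate_sub_invariant_le`,
Meyn–Tweedie 1993 Thm 16.2.4), composed with row 9's `HeatBathSweepErgodic.lean`.  Nothing is
cited as a fact.  Printed counterparts, NAMED ONLY: Meyn–Tweedie 1993 Thm 16.1.5 (uniform
ergodicity ⇒ geometric mixing of bounded functionals); Sokal 1997 lecture notes §2 (exponential vs
integrated autocorrelation); row 8's finite-state `Scoring/IMHAutocorrelationEnvelope.lean`
(`twoTime_abs_le_of_minorized`) is the matrix analogue for independence samplers.

## What is proved (general measurable state space `Ω`, Markov kernel `κ`)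

* `nHit_apply_eq_iterate` — the `t`-step law from `x` is the `t`-th `bind`-iterate of `δ_x`;
  `doeblin_nHit_sub_le` — under Doeblin `κ(x,·) ≥ ε ν` with invariant probability `π`:
  `|κᵗ(x, A) − π(A)| ≤ (1 − ε)ᵗ` for EVERY start `x` (the Literature theorem at a Dirac start).
* `setAutocov κ π t A B = P_π(X₀ ∈ A, X_t ∈ B) − π(A)π(B)` — the stationary two-time covariance of
  two events (joint law `π ⊗ₘ κᵗ`); `setAutocov_eq_setIntegral` — it is `∫_A (κᵗ(x,B) − π(B)) dπ`.
* **`abs_setAutocov_le`** — `|C_t(A, B)| ≤ π(A) (1 − ε)ᵗ` for all events `A, B`, all `t`: every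
  indicator observable of a Doeblin chain in equilibrium (a topological sector, a plaquette bin)
  decorrelates geometrically, uniformly in the second event; `tsum_abs_setAutocov_le` — hence
  `Σ_t |C_t(A, B)| ≤ π(A)/ε` (the integrated autocorrelation of an event is at most `1/ε` in these
  units).
* **`heatBathSweep_abs_setAutocov_le`** — the engine instance: for the single-site heat-bath scan
  of `HeatBathSweepErgodic.lean` (joint density `m ≤ p ≤ M`, scan `l` through every site) in its
  Gibbs law, `|C_t(A, B)| ≤ π(A) (1 − (m/M)^{|l|})ᵗ`.

The constant is the Doeblin one — honest but astronomically weak for a real lattice; the cell's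
autocorrelation figures of merit stay MEASURED.  NOT CLAIMED: general (non-indicator) observables
(bounded `f, g` follow by the same argument, not written), reversibility-based improvements,
spectral gaps, anything about HMC or flows.
-/

namespace Summit.Ventures.LatticeQCDFlow.Exactness

open MeasureTheory ProbabilityTheory
open scoped ENNReal

section Doeblin

variable {Ω : Type*} [MeasurableSpace Ω]

/-- The `t`-step law from `x` is the `t`-th `bind`-iterate of the Dirac law at `x`. -/
theorem nHit_apply_eq_iterate (κ : Kernel Ω Ω) (t : ℕ) (x : Ω) :
    nHit κ t x = (fun m : Measure Ω => m.bind κ)^[t] (Measure.dirac x) := by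
  induction t with
  | zero => rw [nHit_zero, Kernel.id_apply, Function.iterate_zero, id]
  | succ t ih => rw [nHit_succ, Kernel.comp_apply, ih, Function.iterate_succ_apply']

/-- `nHit` of a Markov kernel is Markov. -/
theorem isMarkovKernel_nHit (κ : Kernel Ω Ω) [IsMarkovKernel κ] : ∀ t, IsMarkovKernel (nHit κ t)
  | 0 => by rw [nHit_zero]; infer_instance
  | t + 1 => by
      haveI := isMarkovKernel_nHit κ t
      rw [nHit_succ]; infer_instance

variable {κ : Kernel Ω Ω} [IsMarkovKernel κ] {ν : Measure Ω} [IsProbabilityMeasure ν] {ε : ℝ≥0∞}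
  {π : Measure Ω} [IsProbabilityMeasure π]

/-- **Doeblin at a Dirac start**: `|κᵗ(x, A) − π(A)| ≤ (1 − ε)ᵗ` for every `x`, `t`, `A`. -/
theorem doeblin_nHit_sub_le (hmin : ∀ x {B : Set Ω}, MeasurableSet B → ε * ν B ≤ κ x B) (hε1 : ε ≤ 1)
    (hπ : Kernel.Invariant κ π) (x : Ω) (t : ℕ) (A : Set Ω) :
    |(nHit κ t x).real A - π.real A| ≤ (1 - ε.toReal) ^ t := by
  rw [nHit_apply_eq_iterate]
  exact Literature.Probability.MarkovChains.Doeblin.doeblin_iterate_sub_invariant_le hmin hε1 hπ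
    (Measure.dirac x) t A

variable (κ π) in
/-- **The stationary two-time covariance of two events**:
`C_t(A, B) = P_π(X₀ ∈ A, X_t ∈ B) − π(A) π(B)`, the joint law of `(X₀, X_t)` being `π ⊗ₘ κᵗ`. -/
noncomputable def setAutocov (t : ℕ) (A B : Set Ω) : ℝ :=
  ((π ⊗ₘ nHit κ t) (A ×ˢ B)).toReal - π.real A * π.real B

/-- `C_t(A, B) = ∫_A (κᵗ(x, B) − π(B)) dπ(x)`. -/
theorem setAutocov_eq_setIntegral (t : ℕ) {A B : Set Ω} (hA : MeasurableSet A) (hB : MeasurableSet B) :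
    setAutocov κ π t A B = ∫ x in A, ((nHit κ t x).real B - π.real B) ∂π := by
  haveI := isMarkovKernel_nHit κ t
  have hmeas : Measurable fun x => (nHit κ t x) B := Kernel.measurable_coe _ hB
  have hint : Integrable (fun x => (nHit κ t x).real B) (π.restrict A) :=
    (integrable_const (1 : ℝ)).mono' hmeas.ennreal_toReal.aestronglyMeasurable
      (ae_of_all _ fun x => by
        rw [Real.norm_eq_abs, abs_of_nonneg measureReal_nonneg]
        exact measureReal_le_one)
  rw [integral_sub hint (integrable_const _), setIntegral_const, smul_eq_mul, setAutocov,
    Measure.compProd_apply_prod hA hB,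
    ← integral_toReal hmeas.aemeasurable (ae_of_all _ fun x => measure_lt_top _ _)]
  rfl

/-- **Geometric decorrelation of events for a Doeblin chain in equilibrium**:
`|C_t(A, B)| ≤ π(A) (1 − ε)ᵗ`, uniformly in `B`. -/
theorem abs_setAutocov_le (hmin : ∀ x {B : Set Ω}, MeasurableSet B → ε * ν B ≤ κ x B) (hε1 : ε ≤ 1)
    (hπ : Kernel.Invariant κ π) (t : ℕ) {A B : Set Ω} (hA : MeasurableSet A) (hB : MeasurableSet B) :
    |setAutocov κ π t A B| ≤ π.real A * (1 - ε.toReal) ^ t := by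
  rw [setAutocov_eq_setIntegral t hA hB, ← Real.norm_eq_abs, mul_comm]
  exact norm_setIntegral_le_of_norm_le_const (measure_lt_top _ _) fun x _ => by
    rw [Real.norm_eq_abs]
    exact doeblin_nHit_sub_le hmin hε1 hπ x t B

/-- **Summable correlations**: `Σ_t |C_t(A, B)| ≤ π(A)/ε` (for `ε > 0`). -/
theorem tsum_abs_setAutocov_le (hmin : ∀ x {B : Set Ω}, MeasurableSet B → ε * ν B ≤ κ x B)
    (hε0 : 0 < ε) (hε1 : ε ≤ 1) (hπ : Kernel.Invariant κ π) {A B : Set Ω} (hA : MeasurableSet A)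
    (hB : MeasurableSet B) :
    Summable (fun t => |setAutocov κ π t A B|) ∧
      ∑' t, |setAutocov κ π t A B| ≤ π.real A / ε.toReal := by
  have hεtop : ε ≠ ∞ := ne_top_of_le_ne_top ENNReal.one_ne_top hε1
  have hr0 : 0 ≤ 1 - ε.toReal := sub_nonneg.2 (ENNReal.toReal_le_of_le_ofReal zero_le_one (by simpa using hε1))
  have hr1 : 1 - ε.toReal < 1 := sub_lt_self _ (ENNReal.toReal_pos hε0.ne' hεtop)
  have hgeom : Summable fun t : ℕ => π.real A * (1 - ε.toReal) ^ t :=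
    (summable_geometric_of_lt_one hr0 hr1).mul_left _
  have hle : ∀ t, |setAutocov κ π t A B| ≤ π.real A * (1 - ε.toReal) ^ t :=
    fun t => abs_setAutocov_le hmin hε1 hπ t hA hB
  have hsum : Summable fun t => |setAutocov κ π t A B| :=
    Summable.of_nonneg_of_le (fun t => abs_nonneg _) hle hgeom
  refine ⟨hsum, ?_⟩
  calc ∑' t, |setAutocov κ π t A B| ≤ ∑' t : ℕ, π.real A * (1 - ε.toReal) ^ t :=
        Summable.tsum_le_tsum hle hsum hgeom
    _ = π.real A * (1 - (1 - ε.toReal))⁻¹ := by rw [tsum_mul_left, tsum_geometric_of_lt_one hr0 hr1]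
    _ = π.real A / ε.toReal := by rw [sub_sub_cancel, div_eq_mul_inv]

end Doeblin

/-! ## The engine instance: the heat-bath sweep -/

section HeatBath

variable {ι : Type*} [Fintype ι] [DecidableEq ι] {X : ι → Type*} [∀ i, MeasurableSpace (X i)]
variable {μ : Π i, Measure (X i)} [∀ i, IsProbabilityMeasure (μ i)] {p : (Π j, X j) → ℝ≥0∞}
variable {m M : ℝ≥0∞}

/-- **Events decorrelate geometrically under the heat-bath sweep.**  For the single-site heat-bath
scan over a list `l` through every site, joint density `m ≤ p ≤ M` (`0 < m`, `M < ∞`), run in its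
Gibbs law `π`: `|P_π(X₀ ∈ A, X_t ∈ B) − π(A)π(B)| ≤ π(A) (1 − (m/M)^{|l|})ᵗ` for all events `A, B`. -/
theorem heatBathSweep_abs_setAutocov_le (hp : Measurable p) (hm0 : m ≠ 0) (hMtop : M ≠ ∞)
    (hmp : ∀ ω, m ≤ p ω) (hpM : ∀ ω, p ω ≤ M) {l : List ι} (hl : ∀ i, i ∈ l) (t : ℕ)
    {A B : Set (Π j, X j)} (hA : MeasurableSet A) (hB : MeasurableSet B) :
    |setAutocov (cycle (l.map (siteHeatBath μ p))) (piGibbsLaw μ p) t A B| ≤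
      (piGibbsLaw μ p).real A * (1 - (m.toReal / M.toReal) ^ l.length) ^ t := by
  haveI := isMarkovKernel_heatBathSweep (μ := μ) hp hm0 hMtop hmp hpM l
  haveI := isProbabilityMeasure_piGibbsLaw (μ := μ) (p := p) hm0 hMtop hmp hpM
  haveI : ∀ i, Nonempty (X i) := fun i => nonempty_of_isProbabilityMeasure (μ i)
  have hmin : ∀ x {B : Set (Π j, X j)}, MeasurableSet B →
      (m * M⁻¹) ^ l.length * Measure.pi μ B ≤ cycle (l.map (siteHeatBath μ p)) x B := fun x B hB => by
    have h := Measure.le_iff.1 (heatBathSweep_minorised (μ := μ) hp hm0 hMtop hmp hpM hl x) B hB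
    rwa [Measure.smul_apply, smul_eq_mul] at h
  have hε1 : (m * M⁻¹) ^ l.length ≤ 1 := by
    refine pow_le_one₀ bot_le ?_
    obtain ⟨ω⟩ := (inferInstance : Nonempty (Π j, X j))
    have hmM : m ≤ M := (hmp ω).trans (hpM ω)
    calc m * M⁻¹ ≤ M * M⁻¹ := mul_le_mul' hmM le_rfl
      _ ≤ 1 := ENNReal.mul_inv_le_one M
  have h := abs_setAutocov_le hmin hε1 (heatBathSweep_invariant_piGibbsLaw (μ := μ) hp hm0 hMtop hmp hpM l)
    t hA hB
  rwa [ENNReal.toReal_pow, ENNReal.toReal_mul, ENNReal.toReal_inv, ← div_eq_mul_inv] at h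

end HeatBath

end Summit.Ventures.LatticeQCDFlow.Exactness
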